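import Literature.MathematicalPhysics.QuantumFieldTheory.Balaban1983to89.B9
import Literature.MathematicalPhysics.QuantumFieldTheory.Balaban1983to89.B9SectCDiffEstimate

/-!
# `Balaban1983to89.B9SectCDiffDict` — the DICTIONARY from the printed inequalities (3.42) of B9 Theorem 3.1 (typed
as `B9.Ineq342_346_347` over an abstract `B9.KernelFamily`) to the block-majorant class `OpDec` of hypothesis (M)
of THEOREM D (item (T1c)(b) of the cell brief `b2b-balaban-r1/g11/BRIEF-gen12.md`)

B9 = T. Bałaban, *Propagators for lattice gauge theories in a background field*, Commun. Math. Phys. **99**, 389–434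
(1985) [Balaban1985BackgroundPropagators].

CITATION HEADER (lean-in-tree rule 2026-08-18).  Cell `pub-balaban`, unit `b2b-balaban-r1-g11` (READER GROUP A,
lineage r1, gen 11), journal claim `SECTC-DIFF-DICT` (item (T1c)(b) of `b2b-balaban-r1/g11/BRIEF-gen12.md`).
Source: doi:10.1007/bf01240355, held `paper:balaban1985-cmp99-background-propagators`, journal page = PDF page +
388.  Theorem 3.1 (3.42), p. 397 [PDF 9] (render `run/shared/lean/pub/pub-balaban/b2b-balaban-ref1/pages/
1985-cmp99-background-propagators/1985-cmp99-background-propagators-p009-x2.png`, READ AS AN IMAGE by this unit for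
`…B9SectCDiffEstimate`; quotation re-read against the render by the cell XREAD C-pv07-35, DOCFIX G-pv07-8 O1):
*"the operator G′(U) (a = 1) satisfies the inequalities |(G′(U)λ)(x)|, |(∇_U G′(U)λ)(x)|, |(G′(U)∇*_U λ)(x)|,
|(Δ_U G′(U)λ)(x)| ≤ B₀[(Lʲη)², Lʲη, Lʲη, 1]e^{−δ₀d(y,y′)}|λ| for x ∈ Δ(y), y ∈ Λ_j, supp λ ⊂ Δ(y′); (3.42)"*
— typed in the cell's `B9.Ineq342_346_347` (b09 lineage) over the ABSTRACT observation quantities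
`K.e n U λ y` (= sup_{x∈Δ(y)} of the n-th entry) of a `B9.KernelFamily`, with `B9.pref4 (Lʲη) = [(Lʲη)², Lʲη, Lʲη,
1]`.  Tree inputs (by name): `B9.Geometry`, `B9.Backgrounds`, `B9.KernelFamily`, `B9.pref4`, `B9.Ineq342_346_347`;
`B9SectCDiffEstimate.BlkMaj` (+ `BlkMaj.of_opBound`, v1.1), `WDec`, `Frame`, `OpDec`.  Cell rows: GAPS G-B9-05R
residual (iv) (instantiation of `EstHyp`), C-r1g11-1, C-r1g11-2, this module's row C-r1g11-4.  Mathlib otherwise.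
v1.1 (APPEND-ONLY §2, same unit and claim): the ZONE dictionary for hypothesis (L) — `zoneMaj`, `blkMaj_zoneMaj`,
`wdec_zoneMaj`, `rowZone_zoneMaj`, `opZon_of_cut` (a local operator pair cut by one flat cutoff ⇒ `OpZon`), `opZon_mono`, over
`B9SectCDiff.tdef` / `cutX` and its window-entry lemmas (`tdef_cutX_apply_window_of_agree`, `…_far_right`,
`…_far_left`, `…_far_far`); §3 LOCAL fine operators with general block maps: `locMaj`, `blkMaj_locMaj`,
`opDec_of_local`, `opZon_of_local` (locality count + entrywise size ⇒ `OpDec` / `OpZon`; the (M) classes of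
the fine-row `Q*, Q′*` and the (L) classes of the one-sided coefficient operators — XREAD C-pv07-36 R4-1); §4
closure constructors `wdec_add`, `opDec_add`, `opZon_add` (additivity — the composite `zAm₀`, XREAD C-pv07-37
R5-1) and the ROW-SUM constructors `opDec_of_rowsum`, `opDec_of_rowsum_local`, `opZon_of_rowsum` (the
level-uniform datum for the multilevel coarse-row `Q, Q′`, R5-2); no v1 declaration modified.  v1.2
(unit `b2b-balaban-r1-g12`, DOCSTRING-ONLY): the §4 quotation of p. 414 corrected to the printed *"right-hand side"*
(cell XREAD C-pv04g12-2, misquotation m1 LOW; no declaration touched).  No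
`HarnessLib` fact, no named-fact `Prop` beyond the realization predicate below (a HYPOTHESIS structure), no `sorry`.

## WHAT THIS MODULE DOES

Hypothesis (M) of THEOREM D (`…B9SectCDiffEstimate.EstHyp`, fields `mG₁ … mQ'₂`) asks each one-sequence factor
for a 𝔅-BLOCK MAJORANT in the class `𝒟(0, k, c)`: `BlkMaj` (block row sums) + `WDec` (row weight `sc(y)ᵏ`,
rate `δ₀`).  The printed (3.42) is an ℓ∞(Δ(y′)) → ℓ∞(Δ(y)) bound.  The two are the same statement
(`BlkMaj.of_opBound` / `BlkMaj.opBound` of `…B9SectCDiffEstimate` §5); what this module adds is the passage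
through the cell's ABSTRACT typing of Theorem 3.1:
* `Realizes K n U bu bv T` (a hypothesis structure): the matrix `T` (fine carriers `u`, `v` with block maps to 𝔅)
  is SEEN by the n-th observation quantity of the kernel family `K` at the configuration `U` — every fine source
  `f` supported in the block `y′` with `sup|f| ≤ 1` is represented by some `λ : g.Loc` with `suppIn λ y′`,
  `supNorm λ ≤ 1` and `|(Tf)(x)| ≤ K.e n U λ (bu x)`.  (For n = 0 and `T` = the matrix of `G′(U)`: the
  definition of `e 0` as the sup over `x ∈ Δ(y)`; for n = 1, 2: `T` = the matrix of `∇_U G′`, `G′∇*_U`.)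
* `blkMaj_of_ineq342` : (3.42) (`B9.Ineq342_346_347 K B₀ δ₀ U`, first conjunct) + `Realizes` ⇒
  `BlkMaj bu bv T (B₀·pref4(L^{j(y)}η)_n·e^{−δ₀d(y,y′)})`; `wdec_pref4` : that majorant is `WDec` with the row
  weight `pref4(Lʲη)_n = (Lʲη)^{k_n}`, `k = [2, 1, 1, 0]` (`kpow`, `pref4_eq_zpow`);
* `opDec_of_ineq342` : in any `Frame F` on 𝔅 whose `ρ`, `sc`, `δ₀` ARE `d`, `Lʲη`, `δ₀` (hypotheses `hρ`,
  `hsc`, `hδ`; `rfl` for the geometric frame of `…B9SectCDiffFrame`), `T ∈ 𝒟(0, k_n, B₀)` — the (M) fields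
  `mG`, `mG'` (n = 0, k = 2), `mDG'`-type (n = 1, k = 1) of `EstHyp`, per sequence and per configuration.

## WHAT IS NOT CLAIMED (ABSOLUTE RULE)

Theorem 3.1 is NOT asserted: (3.42) enters as the hypothesis `B9.Ineq342_346_347 K B₀ δ₀ U` (its status is the
cell's record on B9, GAPS G-B9-01 …); no concrete operator is asserted to be realized by any kernel family —
`Realizes` is a hypothesis an instance must prove from its definitions of `Loc`, `suppIn`, `supNorm`, `e`.  The
Q-type factors (k = 0, block-local) and `C = (Q′G′²Q′*)⁻¹` ((3.48), k = −4, with the printed `(L^{j′}η)^{−d}`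
against the counting convention of matrix products) are NOT treated here (unit-block constructors
`OpDec.of_abs_le` of `…B9SectCDiffEstimate` §5).  Value = kernel-certified bookkeeping, NOT summit progress.
-/

namespace Literature.MathematicalPhysics.QuantumFieldTheory.Balaban1983to89.B9SectCDiffDict

open Finset Real
open B9SectCDiffEstimate

section Dict

variable {g : B9.Geometry} {B : B9.Backgrounds}
variable {u v : Type*} [Fintype v]

/-- **REALIZATION of a matrix by an observation quantity of a kernel family** (hypothesis structure): every fine
source `f : v → ℝ` supported in the block `y′` (`bv x′ ≠ y′ → f x′ = 0`) with `sup|f| ≤ 1` is represented by an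
abstract argument `λ : g.Loc` with *"supp λ ⊂ Δ(y′)"* (`g.suppIn λ y′`), `|λ| ≤ 1` (`g.supNorm λ ≤ 1`), and the
observation quantity dominates the entry: `|(Tf)(x)| ≤ K.e n U λ (bu x)` (`e n U λ y` = the sup over `x ∈ Δ(y)`
of the n-th quantity of (3.42)). OURS (typing). [cite: Balaban1985BackgroundPropagators, (3.42) p.397] -/
structure Realizes (K : B9.KernelFamily g B) (n : Fin 4) (U : B.Cfg) (bu : u → g.Site) (bv : v → g.Site)
    (T : Matrix u v ℝ) : Prop where
  rep : ∀ (x : u) (y' : g.Site) (f : v → ℝ), (∀ x', bv x' ≠ y' → f x' = 0) → (∀ x', |f x'| ≤ 1) →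
    ∃ lam : g.Loc, g.suppIn lam y' ∧ g.supNorm lam ≤ 1 ∧ |∑ x', T x x' * f x'| ≤ K.e n U lam (bu x)

/-- the scale powers of the four entries of (3.42): `[2, 1, 1, 0]`. [cite: Balaban1985BackgroundPropagators, (3.42) p.397] -/
def kpow : Fin 4 → ℤ := ![2, 1, 1, 0]

/-- `pref4 t n = t^{kpow n}` (`[t², t, t, 1]`), for `t ≠ 0` not needed: both sides agree at `t = 0` too
(`0² = 0`, `0⁰ = 1`). [folklore] -/
theorem pref4_eq_zpow (t : ℝ) (n : Fin 4) : B9.pref4 t n = t ^ kpow n := by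
  fin_cases n <;> first | (simp [B9.pref4, kpow]; done) | (simp [B9.pref4, kpow]; norm_cast)

/-- `pref4 t n ≥ 0` for `t ≥ 0`. [folklore] -/
theorem pref4_nonneg {t : ℝ} (ht : 0 ≤ t) (n : Fin 4) : 0 ≤ B9.pref4 t n := by
  rw [pref4_eq_zpow]; exact zpow_nonneg ht _

/-- the (3.42) majorant kernel on 𝔅: `B₀·pref4(L^{j(y)}η)_n·e^{−δ₀d(y,y′)}`. OURS (typing).
[cite: Balaban1985BackgroundPropagators, (3.42) p.397] -/
noncomputable def maj342 (g : B9.Geometry) (n : Fin 4) (B₀ δ₀ : ℝ) : Matrix g.Site g.Site ℝ :=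
  fun y y' => B₀ * B9.pref4 (g.len y) n * Real.exp (-(δ₀ * g.dist y y'))

/-- [folklore] -/
theorem maj342_nonneg {B₀ : ℝ} (hB₀ : 0 ≤ B₀) (hlen : ∀ y, 0 ≤ g.len y) (n : Fin 4) (δ₀ : ℝ) (y y' : g.Site) :
    0 ≤ maj342 g n B₀ δ₀ y y' :=
  mul_nonneg (mul_nonneg hB₀ (pref4_nonneg (hlen y) n)) (Real.exp_nonneg _)

/-- **(3.42) ⇒ THE BLOCK MAJORANT**: the first conjunct of `B9.Ineq342_346_347 K B₀ δ₀ U` (*"[…] ≤ B₀[(Lʲη)², Lʲη,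
Lʲη, 1]e^{−δ₀d(y,y′)}|λ| for x ∈ Δ(y), y ∈ Λ_j, supp λ ⊂ Δ(y′)"*) and a realization of `T` by the n-th quantity
give `BlkMaj bu bv T (maj342 g n B₀ δ₀)` (test with the sign pattern of the row on the block:
`BlkMaj.of_opBound`). [cite: Balaban1985BackgroundPropagators, (3.42) p.397] -/
theorem blkMaj_of_ineq342 [DecidableEq g.Site] {K : B9.KernelFamily g B} {B₀ δ₀ : ℝ} {U : B.Cfg}
    (hI : B9.Ineq342_346_347 K B₀ δ₀ U) {n : Fin 4} {bu : u → g.Site} {bv : v → g.Site} {T : Matrix u v ℝ}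
    (hR : Realizes K n U bu bv T) (hB₀ : 0 ≤ B₀) (hlen : ∀ y, 0 ≤ g.len y) :
    BlkMaj bu bv T (maj342 g n B₀ δ₀) := by
  refine BlkMaj.of_opBound (maj342_nonneg hB₀ hlen n δ₀) fun x y' f hf1 hf2 => ?_
  obtain ⟨lam, hsupp, hnorm, hle⟩ := hR.rep x y' f hf1 hf2
  have h342 := hI.1 n lam (bu x) y' hsupp
  have hnn : 0 ≤ B₀ * B9.pref4 (g.len (bu x)) n * Real.exp (-(δ₀ * g.dist (bu x) y')) :=
    maj342_nonneg hB₀ hlen n δ₀ (bu x) y'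
  calc |∑ x', T x x' * f x'| ≤ K.e n U lam (bu x) := hle
    _ ≤ B₀ * B9.pref4 (g.len (bu x)) n * Real.exp (-(δ₀ * g.dist (bu x) y')) * g.supNorm lam := h342
    _ ≤ B₀ * B9.pref4 (g.len (bu x)) n * Real.exp (-(δ₀ * g.dist (bu x) y')) * 1 :=
        mul_le_mul_of_nonneg_left hnorm hnn
    _ = maj342 g n B₀ δ₀ (bu x) y' := by rw [mul_one]; rfl

/-- the (3.42) majorant is row-weighted decay with weight `(Lʲη)^{k_n}`, constant `B₀`, rate `δ₀` (block
positions = the identity of 𝔅). [cite: Balaban1985BackgroundPropagators, (3.42) p.397] -/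
theorem wdec_maj342 {B₀ : ℝ} (hB₀ : 0 ≤ B₀) (hlen : ∀ y, 0 ≤ g.len y) (n : Fin 4) (δ₀ : ℝ) :
    WDec g.dist id id (fun y => g.len y ^ kpow n) B₀ δ₀ (maj342 g n B₀ δ₀) := by
  intro y y'
  rw [abs_of_nonneg (maj342_nonneg hB₀ hlen n δ₀ y y')]
  show B₀ * B9.pref4 (g.len y) n * Real.exp (-(δ₀ * g.dist y y')) ≤ _
  rw [pref4_eq_zpow]
  rfl

/-- **(3.42) ⇒ HYPOTHESIS (M)**: in a frame `F` on 𝔅 with `F.ρ = d`, `F.sc = Lʲη`, `F.δ₀ = δ₀`, a matrix realized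
by the n-th quantity of a kernel family satisfying (3.42) at `U` is in the class `𝒟(0, k_n, B₀)` of
`…B9SectCDiffEstimate` — the fields `mG`/`mG'` (n = 0, k = 2) and the `∇G′`/`G∇*`-type fields (n = 1, 2; k = 1) of
`EstHyp`, per sequence. [cite: Balaban1985BackgroundPropagators, (3.42) p.397 + Thm 3.3 p.399] -/
theorem opDec_of_ineq342 [DecidableEq g.Site] (F : Frame g.Site) {δ₀ : ℝ} (hρ : F.ρ = g.dist)
    (hsc : F.sc = g.len) (hδ : F.δ₀ = δ₀) {K : B9.KernelFamily g B} {B₀ : ℝ} {U : B.Cfg} (hI : B9.Ineq342_346_347 K B₀ δ₀ U)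
    {n : Fin 4} {bu : u → g.Site} {bv : v → g.Site} {T : Matrix u v ℝ} (hR : Realizes K n U bu bv T)
    (hB₀ : 0 ≤ B₀) (hlen : ∀ y, 0 ≤ g.len y) :
    OpDec F bu bv id id 0 (kpow n) B₀ T := by
  refine OpDec.of_parts (blkMaj_of_ineq342 hI hR hB₀ hlen) ?_
  rw [F.rate_zero, hρ, hsc, hδ]
  exact wdec_maj342 hB₀ hlen n δ₀

/-- the powers by name: `kpow 0 = 2` (G, G′), `kpow 1 = kpow 2 = 1` (∇G′, G∇*), `kpow 3 = 0` (ΔG). [folklore] -/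
theorem kpow_vals : kpow 0 = 2 ∧ kpow 1 = 1 ∧ kpow 2 = 1 ∧ kpow 3 = 0 := by
  refine ⟨rfl, rfl, rfl, rfl⟩

end Dict

/-! ## §2 (v1.1, APPEND-ONLY) The ZONE dictionary: a LOCAL operator pair cut by one flat cutoff ⇒ `OpZon`
(hypothesis (L) of THEOREM D for the pure defects `𝔇(Q), 𝔇(Q*), 𝔇(Q′), 𝔇(Q′*), 𝔇(∂), 𝔇(∂*), 𝔇(A)`)

The entries of `𝔇(T) = tdef (cutX f₁ f₂ ψ) (cutX e₁ e₂ χ) T₁ T₂` are known (`B9SectCDiff` §5): window × window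
`(ψ(a) − χ(v))·T(a,v)` when the pair AGREES on the windows (`tdef_cutX_apply_window_of_agree`), window × far
`ψ(a)·T₂(a,t)`, far × window `−T₁(s,v)·χ(v)`, far × far `0`.  For a LOCAL operator (range ≤ one block) and a cutoff
of the h_□-class (p. 408: *"We take the partition of unity {h_□} defined at the end of Sect. A in [4]"*; flat to
`O(M⁻¹)` across one block — p. 414, after (3.100): *"… with coefficients determined by derivatives of the function
h. They are of the order O(M⁻¹), or O(M⁻²), if considered on a proper scale"*) the mixed entries vanish by support
(`ψ = 0`, resp. `χ = 0`,
within range of the windows' edges) and `|ψ(a) − χ(v)| ≤ ϑ(y_a) ≤ θ₀·sc(y_a)^{k₁}` on the support of `T` (flatness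
read at the row block, ON THE PROPER SCALE); so `𝔇(T)` has the block majorant `ϑ·K_T` on the rows where the
cutoff is not constant across the support (the ZONE) and `0` elsewhere — `zoneMaj` — and
`𝔇(T) ∈ 𝒵(k₁ + k₂, θ₀·c)` whenever the window part of `T` has a mixed-block majorant `K_T ∈` `WDec(sc^{k₂}, c, δ₀)`
(`opZon_of_cut`; e.g. `(k₁,k₂) = (0,0)` for the averaging operators, `(−1,0)` for `∂`: only the PRODUCT `θ₀c` is the
uniform `O(M⁻¹)`).  Everything here is HYPOTHESIS-to-class bookkeeping: agreement,
far-vanishing, flatness, zone location and `K_T` are supplied by the instance (the assembler's lattice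
computations, cell rows C-B9-21 / G-B9-24 (i)); nothing printed is asserted. -/

section ZoneDict

open B9SectCDiff (tdef cutX)

variable {S : Type*} {F : Frame S}
variable {u₁ u₂ v₁ v₂ mu mv U₁ U₂ : Type*} [Fintype u₂] [Fintype v₁] [Fintype v₂] [Fintype mu] [Fintype mv]
  [DecidableEq u₁] [DecidableEq u₂] [DecidableEq v₁] [DecidableEq v₂] [DecidableEq U₂]
variable {f₁ : mu → u₁} {f₂ : mu → u₂} {e₁ : mv → v₁} {e₂ : mv → v₂} {ψ : mu → ℝ} {χ : mv → ℝ}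
  {T₁ : Matrix u₁ v₁ ℝ} {T₂ : Matrix u₂ v₂ ℝ} {bu : u₁ → U₁} {bv : v₂ → U₂} {p₁ : U₁ → S} {p₂ : U₂ → S}

/-- **window row of `𝔇(T)`**: if the pair agrees on the windows and `ψ(a)·T₂(a,t) = 0` for every far column `t`
(locality of `T₂` + `ψ = 0` near the source window's edge), the block row sums of `𝔇(T)` at the window row `a` are
the commutator sums `Σ_v |ψ(a) − χ(v)|·|T(a,v)|`. [folklore] -/
theorem tdef_rowsum_window (hf₁ : Function.Injective f₁) (he₂ : Function.Injective e₂)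
    (hagree : ∀ a v, T₁ (f₁ a) (e₁ v) = T₂ (f₂ a) (e₂ v))
    (hfarR : ∀ a t, (¬ ∃ v, e₂ v = t) → ψ a * T₂ (f₂ a) t = 0) (a : mu) (J : U₂) :
    ∑ y ∈ univ.filter (fun y => bv y = J), |tdef (cutX f₁ f₂ ψ) (cutX e₁ e₂ χ) T₁ T₂ (f₁ a) y| =
      ∑ v ∈ univ.filter (fun v => bv (e₂ v) = J), |ψ a - χ v| * |T₂ (f₂ a) (e₂ v)| := by
  classical
  set A := univ.filter (fun y : v₂ => bv y = J) with hA
  set B := univ.filter (fun v : mv => bv (e₂ v) = J) with hB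
  have hsub : B.image e₂ ⊆ A := by
    intro y hy
    obtain ⟨v, hv, rfl⟩ := mem_image.1 hy
    exact mem_filter.2 ⟨mem_univ _, (mem_filter.1 hv).2⟩
  have hvan : ∀ y ∈ A, y ∉ B.image e₂ → |tdef (cutX f₁ f₂ ψ) (cutX e₁ e₂ χ) T₁ T₂ (f₁ a) y| = 0 := by
    intro y hy hyB
    have hfar : ¬ ∃ v, e₂ v = y := by
      rintro ⟨v, rfl⟩
      exact hyB (mem_image.2 ⟨v, mem_filter.2 ⟨mem_univ _, (mem_filter.1 hy).2⟩, rfl⟩)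
    rw [B9SectCDiff.tdef_cutX_apply_far_right hf₁ ψ χ T₁ T₂ a hfar, hfarR a y hfar, abs_zero]
  rw [← sum_subset hsub hvan, sum_image fun x _ y _ h => he₂ h]
  refine sum_congr rfl fun v _ => ?_
  rw [B9SectCDiff.tdef_cutX_apply_window_of_agree hf₁ he₂ ψ χ (hagree a v), abs_mul]

/-- **far row of `𝔇(T)`**: if `T₁(s,v)·χ(v) = 0` for every far row `s` (locality of `T₁` + `χ = 0` near the
target window's edge), the far rows of `𝔇(T)` vanish. [folklore] -/
theorem tdef_rowsum_far (he₂ : Function.Injective e₂)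
    (hfarL : ∀ s v, (¬ ∃ a, f₁ a = s) → T₁ s (e₁ v) * χ v = 0) {s : u₁} (hs : ¬ ∃ a, f₁ a = s) (J : U₂) :
    ∑ y ∈ univ.filter (fun y => bv y = J), |tdef (cutX f₁ f₂ ψ) (cutX e₁ e₂ χ) T₁ T₂ s y| = 0 := by
  refine sum_eq_zero fun y _ => ?_
  by_cases hy : ∃ v, e₂ v = y
  · obtain ⟨v, rfl⟩ := hy
    rw [B9SectCDiff.tdef_cutX_apply_far_left he₂ ψ χ T₁ T₂ hs v, hfarL s v hs, neg_zero, abs_zero]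
  · rw [B9SectCDiff.tdef_cutX_apply_far_far ψ χ T₁ T₂ hs hy, abs_zero]

open Classical in
/-- **the zone majorant** of `𝔇(T)`: `ϑ(I)·K_T(I,J)` on the row blocks `I` containing a window row `a` at which
the cutoff is NOT constant across the support of `T(a,·)` (`ψ(a) ≠ χ(v)` for some `v` with `T(a,v) ≠ 0`), `0` on
all other row blocks; `ϑ(I)` = the flatness of the cutoff across the support, read at the row block ("on the
proper scale": `ϑ = θ₀·sc^{k₁}`). OURS (typing). [folklore] -/
noncomputable def zoneMaj (f₁ : mu → u₁) (f₂ : mu → u₂) (e₂ : mv → v₂) (ψ : mu → ℝ) (χ : mv → ℝ)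
    (T₂ : Matrix u₂ v₂ ℝ) (bu : u₁ → U₁) (ϑ : U₁ → ℝ) (KT : Matrix U₁ U₂ ℝ) : Matrix U₁ U₂ ℝ :=
  fun I J => if ∃ a v, bu (f₁ a) = I ∧ T₂ (f₂ a) (e₂ v) ≠ 0 ∧ ψ a ≠ χ v then ϑ I * KT I J else 0

variable {ϑ : U₁ → ℝ} {KT : Matrix U₁ U₂ ℝ}

omit [Fintype u₂] [Fintype v₂] [DecidableEq u₁] [DecidableEq u₂] [DecidableEq v₂] [DecidableEq U₂] in
/-- [folklore] -/
theorem zoneMaj_nonneg (hϑ : ∀ I, 0 ≤ ϑ I) (hK : ∀ I J, 0 ≤ KT I J) (I : U₁) (J : U₂) :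
    0 ≤ zoneMaj f₁ f₂ e₂ ψ χ T₂ bu ϑ KT I J := by
  unfold zoneMaj; split_ifs
  · exact mul_nonneg (hϑ I) (hK I J)
  · exact le_rfl

omit [Fintype u₂] [Fintype v₂] [DecidableEq u₁] [DecidableEq u₂] [DecidableEq v₂] [DecidableEq U₂] in
/-- [folklore] -/
theorem zoneMaj_le (hϑ : ∀ I, 0 ≤ ϑ I) (hK : ∀ I J, 0 ≤ KT I J) (I : U₁) (J : U₂) :
    zoneMaj f₁ f₂ e₂ ψ χ T₂ bu ϑ KT I J ≤ ϑ I * KT I J := by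
  unfold zoneMaj; split_ifs
  · exact le_rfl
  · exact mul_nonneg (hϑ I) (hK I J)

/-- **`zoneMaj` majorises `𝔇(T)`** under: agreement on the windows, far-vanishing on both sides, FLATNESS of the
cutoff across the support read at the row block (`T(a,v) ≠ 0 ⇒ |ψ(a) − χ(v)| ≤ ϑ(y_a)` — the h_□-class on the
proper scale) and a mixed-block majorant `K_T` of the window part of `T` (rows blocked by sequence 1 via `f₁`,
columns by sequence 2). [cite: Balaban1985BackgroundPropagators, (3.100) p.413] -/
theorem blkMaj_zoneMaj (hf₁ : Function.Injective f₁) (he₂ : Function.Injective e₂)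
    (hagree : ∀ a v, T₁ (f₁ a) (e₁ v) = T₂ (f₂ a) (e₂ v))
    (hfarR : ∀ a t, (¬ ∃ v, e₂ v = t) → ψ a * T₂ (f₂ a) t = 0)
    (hfarL : ∀ s v, (¬ ∃ a, f₁ a = s) → T₁ s (e₁ v) * χ v = 0)
    (hflat : ∀ a v, T₂ (f₂ a) (e₂ v) ≠ 0 → |ψ a - χ v| ≤ ϑ (bu (f₁ a))) (hϑ : ∀ I, 0 ≤ ϑ I)
    (hK : ∀ I J, 0 ≤ KT I J)
    (hKT : ∀ a J, ∑ v ∈ univ.filter (fun v => bv (e₂ v) = J), |T₂ (f₂ a) (e₂ v)| ≤ KT (bu (f₁ a)) J) :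
    BlkMaj bu bv (tdef (cutX f₁ f₂ ψ) (cutX e₁ e₂ χ) T₁ T₂) (zoneMaj f₁ f₂ e₂ ψ χ T₂ bu ϑ KT) where
  nonneg := zoneMaj_nonneg hϑ hK
  le x J := by
    classical
    by_cases hx : ∃ a, f₁ a = x
    · obtain ⟨a, rfl⟩ := hx
      rw [tdef_rowsum_window hf₁ he₂ hagree hfarR a J]
      by_cases hc : ∃ a' v, bu (f₁ a') = bu (f₁ a) ∧ T₂ (f₂ a') (e₂ v) ≠ 0 ∧ ψ a' ≠ χ v
      · have hz : zoneMaj f₁ f₂ e₂ ψ χ T₂ bu ϑ KT (bu (f₁ a)) J = ϑ (bu (f₁ a)) * KT (bu (f₁ a)) J := by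
          unfold zoneMaj; rw [if_pos hc]
        rw [hz]
        calc ∑ v ∈ univ.filter (fun v => bv (e₂ v) = J), |ψ a - χ v| * |T₂ (f₂ a) (e₂ v)|
            ≤ ∑ v ∈ univ.filter (fun v => bv (e₂ v) = J), ϑ (bu (f₁ a)) * |T₂ (f₂ a) (e₂ v)| :=
              sum_le_sum fun v _ => by
                by_cases h0 : T₂ (f₂ a) (e₂ v) = 0
                · rw [h0, abs_zero, mul_zero, mul_zero]
                · exact mul_le_mul_of_nonneg_right (hflat a v h0) (abs_nonneg _)
          _ = ϑ (bu (f₁ a)) * ∑ v ∈ univ.filter (fun v => bv (e₂ v) = J), |T₂ (f₂ a) (e₂ v)| := by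
              rw [mul_sum]
          _ ≤ ϑ (bu (f₁ a)) * KT (bu (f₁ a)) J := mul_le_mul_of_nonneg_left (hKT a J) (hϑ _)
      · have h0 : ∀ v, |ψ a - χ v| * |T₂ (f₂ a) (e₂ v)| = 0 := by
          intro v
          by_cases hT : T₂ (f₂ a) (e₂ v) = 0
          · rw [hT, abs_zero, mul_zero]
          · by_cases hψ : ψ a = χ v
            · rw [hψ, sub_self, abs_zero, zero_mul]
            · exact absurd ⟨a, v, rfl, hT, hψ⟩ hc
        rw [sum_eq_zero fun v _ => h0 v]
        exact zoneMaj_nonneg hϑ hK _ _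
    · rw [tdef_rowsum_far he₂ hfarL hx J]
      exact zoneMaj_nonneg hϑ hK _ _

omit [Fintype u₂] [Fintype v₂] [DecidableEq u₁] [DecidableEq u₂] [DecidableEq v₂] [DecidableEq U₂] in
/-- **decay of the zone majorant, with the scales added**: flatness `ϑ ≤ θ₀·sc^{k₁}` at the row block and
`K_T ∈ WDec(sc^{k₂}, c, δ₀)` ⇒ `zoneMaj ∈ WDec(sc^{k₁+k₂}, θ₀c, δ₀)` — e.g. `(k₁, k₂) = (0, 0)` for the averaging
operators (`θ₀ = O(M⁻¹)`), `(−1, 0)` for `∂` (range `η`: `|ψ(a) − χ(v)| ≤ η·sup|∇h| ≤ (O(1)η/M)·(Lʲη)⁻¹`, row sums of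
`|∂| ≤ 2d·η⁻¹`; the product `O(1)·2d/M` is the uniform constant). [folklore] -/
theorem wdec_zoneMaj (hF : F.Valid) {k₁ k₂ : ℤ} {θ₀ c : ℝ} (hϑ : ∀ I, 0 ≤ ϑ I)
    (hϑle : ∀ I, ϑ I ≤ θ₀ * F.sc (p₁ I) ^ k₁) (hθ₀ : 0 ≤ θ₀) (hK : ∀ I J, 0 ≤ KT I J)
    (hW : WDec F.ρ p₁ p₂ (fun a => F.sc a ^ k₂) c (F.rate 0) KT) :
    WDec F.ρ p₁ p₂ (fun a => F.sc a ^ (k₁ + k₂)) (θ₀ * c) (F.rate 0)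
      (zoneMaj f₁ f₂ e₂ ψ χ T₂ bu ϑ KT) := by
  intro I J
  rw [abs_of_nonneg (zoneMaj_nonneg hϑ hK I J)]
  refine (zoneMaj_le hϑ hK I J).trans ?_
  have h := hW I J
  rw [abs_of_nonneg (hK I J)] at h
  calc ϑ I * KT I J
      ≤ (θ₀ * F.sc (p₁ I) ^ k₁) * (c * F.sc (p₁ I) ^ k₂ * Real.exp (-(F.rate 0 * F.ρ (p₁ I) (p₂ J)))) :=
        mul_le_mul (hϑle I) h (hK I J) (mul_nonneg hθ₀ (hF.sc_zpow_nonneg k₁ _))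
    _ = θ₀ * c * (F.sc (p₁ I) ^ k₁ * F.sc (p₁ I) ^ k₂) * Real.exp (-(F.rate 0 * F.ρ (p₁ I) (p₂ J))) := by
        ring
    _ = θ₀ * c * F.sc (p₁ I) ^ (k₁ + k₂) * Real.exp (-(F.rate 0 * F.ρ (p₁ I) (p₂ J))) := by
        rw [hF.sc_zpow_add k₁ k₂]

omit [Fintype u₂] [Fintype v₂] [DecidableEq u₁] [DecidableEq u₂] [DecidableEq v₂] [DecidableEq U₂] in
/-- **the zone rows**: if every window row at which the cutoff is not constant across the support of `T` sits in a
block of depth `β = 0` (the block lies in the zone `N` of the frame), `zoneMaj` is a `RowZone` kernel. [folklore] -/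
theorem rowZone_zoneMaj
    (hzone : ∀ a v, T₂ (f₂ a) (e₂ v) ≠ 0 → ψ a ≠ χ v → F.β (p₁ (bu (f₁ a))) = 0) :
    RowZone F.β p₁ (zoneMaj f₁ f₂ e₂ ψ χ T₂ bu ϑ KT) := by
  classical
  intro I J hIJ
  unfold zoneMaj at hIJ
  split_ifs at hIJ with hc
  · obtain ⟨a, v, hI, hT, hψ⟩ := hc
    rw [← hI]; exact hzone a v hT hψ
  · exact absurd rfl hIJ

/-- **THE ZONE DICTIONARY**: a local operator pair agreeing on the windows, cut by one cutoff that is flat to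
`θ₀·sc^{k₁}` across the support (read at the row block) and constant off the zone, with a mixed-block majorant
of the window part in `WDec(sc^{k₂}, c, δ₀)`, has `𝔇(T) ∈ 𝒵(k₁ + k₂, θ₀·c)` — the shape of the (L) fields
`zQ, zQt, zQ', zQ't` (class 0), `zD, zDt` (class −1), `zA` (class −2) of `EstHyp`. OURS (the printed claim is the
O(M⁻¹) sentence of p. 414). [cite: Balaban1985BackgroundPropagators, (3.100) p.413] -/
theorem opZon_of_cut (hF : F.Valid) {k₁ k₂ : ℤ} {θ₀ c : ℝ} (hf₁ : Function.Injective f₁)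
    (he₂ : Function.Injective e₂) (hagree : ∀ a v, T₁ (f₁ a) (e₁ v) = T₂ (f₂ a) (e₂ v))
    (hfarR : ∀ a t, (¬ ∃ v, e₂ v = t) → ψ a * T₂ (f₂ a) t = 0)
    (hfarL : ∀ s v, (¬ ∃ a, f₁ a = s) → T₁ s (e₁ v) * χ v = 0)
    (hflat : ∀ a v, T₂ (f₂ a) (e₂ v) ≠ 0 → |ψ a - χ v| ≤ ϑ (bu (f₁ a))) (hϑ : ∀ I, 0 ≤ ϑ I)
    (hϑle : ∀ I, ϑ I ≤ θ₀ * F.sc (p₁ I) ^ k₁) (hθ₀ : 0 ≤ θ₀) (hK : ∀ I J, 0 ≤ KT I J)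
    (hKT : ∀ a J, ∑ v ∈ univ.filter (fun v => bv (e₂ v) = J), |T₂ (f₂ a) (e₂ v)| ≤ KT (bu (f₁ a)) J)
    (hW : WDec F.ρ p₁ p₂ (fun a => F.sc a ^ k₂) c (F.rate 0) KT)
    (hzone : ∀ a v, T₂ (f₂ a) (e₂ v) ≠ 0 → ψ a ≠ χ v → F.β (p₁ (bu (f₁ a))) = 0) :
    OpZon F bu bv p₁ p₂ (k₁ + k₂) (θ₀ * c) (tdef (cutX f₁ f₂ ψ) (cutX e₁ e₂ χ) T₁ T₂) :=
  ⟨zoneMaj f₁ f₂ e₂ ψ χ T₂ bu ϑ KT, blkMaj_zoneMaj hf₁ he₂ hagree hfarR hfarL hflat hϑ hK hKT,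
    wdec_zoneMaj hF hϑ hϑle hθ₀ hK hW, rowZone_zoneMaj hzone⟩

omit [Fintype u₂] [Fintype v₁] [Fintype mu] [Fintype mv] [DecidableEq u₁] [DecidableEq u₂] [DecidableEq v₁]
  [DecidableEq v₂] in
/-- monotonicity of `𝒵(k, θ)` in `θ` (for collecting the seven (L) fields under one common `θ`; cell XREAD
C-pv07-36 R4-2). [folklore] -/
theorem opZon_mono (hF : F.Valid) {k : ℤ} {θ θ' : ℝ} {T : Matrix u₁ v₂ ℝ} (h : OpZon F bu bv p₁ p₂ k θ T)
    (hθ0 : 0 ≤ θ) (hθ : θ ≤ θ') : OpZon F bu bv p₁ p₂ k θ' T := by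
  obtain ⟨K, hK, hW, hR⟩ := h
  exact ⟨K, hK, hW.mono hF.hρ (hF.sc_zpow_nonneg k) hθ0 hθ le_rfl, hR⟩

end ZoneDict


/-! ## §3 (v1.1, APPEND-ONLY) LOCAL fine operators: entrywise size + locality count ⇒ `OpDec` / `OpZon`
(the (M) classes of the local operators `Q, Q*, Q′, Q′*` and the (L) classes of the six one-sided COEFFICIENT
operators `Lm₁, Lm₀, Dm₁, Dm₀, Am₁, Am₀` of `EstHyp` — cell XREAD C-pv07-36 R4-1 — with GENERAL block maps)

A fine-lattice operator with at most `m` non-zero entries per row, each bounded by `θ₁·sc(y_x)ᵏ·e^{−δ·d(y_x,y_x′)}`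
(`y_x` = the block of the row, `y_x′` = the block of the column), has the block majorant `locMaj` = `m·θ₁·scᵏ·e^{−δd}`
on the block pairs carrying a non-zero entry and `0` elsewhere; hence it is in `𝒟ₙ(k, mθ₁)` (`opDec_of_local`), and
if moreover its non-zero rows lie in blocks of depth `β = 0` it is in `𝒵(k, mθ₁)` (`opZon_of_local`).  This is
`OpDec.of_abs_le` / `OpZon.of_abs_le` of `…B9SectCDiffEstimate` §5 with arbitrary (not identity) block maps; the
locality count `m` (e.g. `(2r+1)ᵈ` for range `r`; `Lᵈ` for a ONE-LEVEL averaging block) and `θ₁` are the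
instance's.  Caveat (XREAD C-pv07-37 R5-2): for the MULTILEVEL averaging operators `Q(𝔅(□)), Q′` of p. 408 with
COARSE rows a global pair `(m, θ₁)` is balanced only row by row, not level-uniformly — use the row-sum constructors
`opDec_of_rowsum[_local]` of §4 there; this § is the tool for the fine-row `Q*, Q′*` and for the six (∇h)-coefficient
operators of hypothesis (L). -/

section Local

variable {S : Type*} {F : Frame S}
variable {u v U V : Type*} [Fintype v] [DecidableEq V] {bu : u → U} {bv : v → V} {pU : U → S} {pV : V → S}

open Classical in
/-- the block majorant of a local fine operator: `w I J` on block pairs carrying a non-zero entry, else `0`.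
OURS (typing). [folklore] -/
noncomputable def locMaj (bu : u → U) (bv : v → V) (T : Matrix u v ℝ) (w : U → V → ℝ) : Matrix U V ℝ :=
  fun I J => if ∃ x x', bu x = I ∧ bv x' = J ∧ T x x' ≠ 0 then w I J else 0

variable {T : Matrix u v ℝ} {w : U → V → ℝ}

omit [Fintype v] [DecidableEq V] in
/-- [folklore] -/
theorem locMaj_nonneg (hw : ∀ I J, 0 ≤ w I J) (I : U) (J : V) : 0 ≤ locMaj bu bv T w I J := by
  unfold locMaj; split_ifs
  · exact hw I J
  · exact le_rfl

omit [Fintype v] [DecidableEq V] in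
/-- [folklore] -/
theorem locMaj_le (hw : ∀ I J, 0 ≤ w I J) (I : U) (J : V) : locMaj bu bv T w I J ≤ w I J := by
  unfold locMaj; split_ifs
  · exact le_rfl
  · exact hw I J

omit [Fintype v] [DecidableEq V] in
/-- [folklore] -/
theorem locMaj_ne_zero {I : U} {J : V} (h : locMaj bu bv T w I J ≠ 0) :
    ∃ x x', bu x = I ∧ bv x' = J ∧ T x x' ≠ 0 := by
  unfold locMaj at h
  split_ifs at h with hc
  · exact hc
  · exact absurd rfl h

/-- **locality count + entrywise bound ⇒ block majorant**: at most `m` non-zero entries per row, each `≤ w/m` read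
at the block pair, gives `BlkMaj bu bv T (locMaj bu bv T w)`. [folklore] -/
theorem blkMaj_locMaj {m : ℕ} (hw : ∀ I J, 0 ≤ w I J)
    (hcard : ∀ x, (univ.filter (fun x' => T x x' ≠ 0)).card ≤ m)
    (hsup : ∀ x x', T x x' ≠ 0 → (m : ℝ) * |T x x'| ≤ w (bu x) (bv x')) :
    BlkMaj bu bv T (locMaj bu bv T w) where
  nonneg := locMaj_nonneg hw
  le x J := by
    classical
    set A := univ.filter (fun x' : v => bv x' = J) with hA
    set B := A.filter (fun x' => T x x' ≠ 0) with hB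
    have hAB : ∑ x' ∈ B, |T x x'| = ∑ x' ∈ A, |T x x'| :=
      sum_filter_of_ne fun x' _ h h0 => h (by rw [h0, abs_zero])
    rw [← hAB]
    by_cases hne : B.Nonempty
    · obtain ⟨x₀, hx₀⟩ := hne
      have hx₀' := mem_filter.1 hx₀
      have hJ : bv x₀ = J := (mem_filter.1 hx₀'.1).2
      have hK : locMaj bu bv T w (bu x) J = w (bu x) J := by
        unfold locMaj; rw [if_pos ⟨x, x₀, rfl, hJ, hx₀'.2⟩]
      rw [hK]
      have hm : 0 < (m : ℝ) := by
        have h1 : 1 ≤ (univ.filter (fun x' => T x x' ≠ 0)).card :=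
          card_pos.2 ⟨x₀, mem_filter.2 ⟨mem_univ _, hx₀'.2⟩⟩
        exact_mod_cast h1.trans (hcard x)
      have hBcard : (B.card : ℝ) ≤ m := by
        have : B.card ≤ (univ.filter (fun x' => T x x' ≠ 0)).card :=
          card_le_card fun x' hx' => mem_filter.2 ⟨mem_univ _, (mem_filter.1 hx').2⟩
        exact_mod_cast this.trans (hcard x)
      have hterm : ∀ x' ∈ B, |T x x'| ≤ w (bu x) J / m := by
        intro x' hx'
        have h' := mem_filter.1 hx'
        have hJ' : bv x' = J := (mem_filter.1 h'.1).2
        rw [le_div_iff₀ hm, mul_comm, ← hJ']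
        exact hsup x x' h'.2
      calc ∑ x' ∈ B, |T x x'| ≤ ∑ _x' ∈ B, w (bu x) J / m := sum_le_sum hterm
        _ = B.card * (w (bu x) J / m) := by rw [sum_const, nsmul_eq_mul]
        _ ≤ m * (w (bu x) J / m) :=
          mul_le_mul_of_nonneg_right hBcard (div_nonneg (hw _ _) hm.le)
        _ = w (bu x) J := mul_div_cancel₀ _ hm.ne'
    · rw [not_nonempty_iff_eq_empty.1 hne, sum_empty]
      exact locMaj_nonneg hw _ _

/-- **(M) class of a local fine operator**: `≤ m` non-zero entries per row, each
`≤ θ₁·sc(y_x)ᵏ·e^{−rateₙ·d(y_x,y_x′)}` ⇒ `T ∈ 𝒟ₙ(k, m·θ₁)`. [folklore] -/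
theorem opDec_of_local (hF : F.Valid) {n m : ℕ} {k : ℤ} {θ₁ : ℝ} (hθ : 0 ≤ θ₁)
    (hcard : ∀ x, (univ.filter (fun x' => T x x' ≠ 0)).card ≤ m)
    (hsup : ∀ x x', T x x' ≠ 0 →
      |T x x'| ≤ θ₁ * F.sc (pU (bu x)) ^ k * Real.exp (-(F.rate n * F.ρ (pU (bu x)) (pV (bv x'))))) :
    OpDec F bu bv pU pV n k (m * θ₁) T := by
  set w : U → V → ℝ := fun I J => m * θ₁ * F.sc (pU I) ^ k * Real.exp (-(F.rate n * F.ρ (pU I) (pV J)))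
    with hw
  have hw0 : ∀ I J, 0 ≤ w I J := fun I J =>
    mul_nonneg (mul_nonneg (mul_nonneg (Nat.cast_nonneg m) hθ) (hF.sc_zpow_nonneg k _)) (Real.exp_nonneg _)
  refine OpDec.of_parts (blkMaj_locMaj hw0 hcard fun x x' h => ?_) fun I J => ?_
  · calc (m : ℝ) * |T x x'|
        ≤ m * (θ₁ * F.sc (pU (bu x)) ^ k * Real.exp (-(F.rate n * F.ρ (pU (bu x)) (pV (bv x'))))) :=
          mul_le_mul_of_nonneg_left (hsup x x' h) (Nat.cast_nonneg m)
      _ = w (bu x) (bv x') := by rw [hw]; ring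
  · rw [abs_of_nonneg (locMaj_nonneg hw0 I J)]
    exact (locMaj_le hw0 I J).trans (le_of_eq (by rw [hw]))

/-- **(L) class of a local fine operator supported in the zone**: `≤ m` non-zero entries per row, each
`≤ θ₁·sc(y_x)ᵏ·e^{−δ₀·d(y_x,y_x′)}`, non-zero rows in blocks of depth `β = 0` ⇒ `T ∈ 𝒵(k, m·θ₁)` — the form in
which the one-sided coefficient operators `Lm₁, Lm₀, Dm₁, Dm₀, Am₁, Am₀` (first-order operators *"with
coefficients determined by derivatives of the function h … of the order O(M⁻¹), or O(M⁻²), if considered on a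
proper scale"*, p. 414) enter `EstHyp`. [cite: Balaban1985BackgroundPropagators, (3.100) p.413] -/
theorem opZon_of_local (hF : F.Valid) {m : ℕ} {k : ℤ} {θ₁ : ℝ} (hθ : 0 ≤ θ₁)
    (hcard : ∀ x, (univ.filter (fun x' => T x x' ≠ 0)).card ≤ m)
    (hsup : ∀ x x', T x x' ≠ 0 →
      |T x x'| ≤ θ₁ * F.sc (pU (bu x)) ^ k * Real.exp (-(F.δ₀ * F.ρ (pU (bu x)) (pV (bv x')))))
    (hz : ∀ x x', T x x' ≠ 0 → F.β (pU (bu x)) = 0) : OpZon F bu bv pU pV k (m * θ₁) T := by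
  set w : U → V → ℝ := fun I J => m * θ₁ * F.sc (pU I) ^ k * Real.exp (-(F.rate 0 * F.ρ (pU I) (pV J)))
    with hw
  have hw0 : ∀ I J, 0 ≤ w I J := fun I J =>
    mul_nonneg (mul_nonneg (mul_nonneg (Nat.cast_nonneg m) hθ) (hF.sc_zpow_nonneg k _)) (Real.exp_nonneg _)
  refine OpZon.of_parts (blkMaj_locMaj hw0 hcard fun x x' h => ?_) (fun I J => ?_) fun I J hK => ?_
  · calc (m : ℝ) * |T x x'|
        ≤ m * (θ₁ * F.sc (pU (bu x)) ^ k * Real.exp (-(F.δ₀ * F.ρ (pU (bu x)) (pV (bv x'))))) :=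
          mul_le_mul_of_nonneg_left (hsup x x' h) (Nat.cast_nonneg m)
      _ = w (bu x) (bv x') := by rw [hw, F.rate_zero]; ring
  · rw [abs_of_nonneg (locMaj_nonneg hw0 I J)]
    exact (locMaj_le hw0 I J).trans (le_of_eq (by rw [hw]))
  · obtain ⟨x, x', hI, -, hT⟩ := locMaj_ne_zero hK
    rw [← hI]; exact hz x x' hT

end Local

/-! ## §4 (v1.1, APPEND-ONLY) Closure constructors: additivity and the ROW-SUM constructors

Kernel lemmas suggested (as a checked scratch) by the cell cross-read XREAD C-pv07-37 (pv07 lineage), re-proved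
here in the module's own namespace [folklore]: `wdec_add` / `opDec_add` / `opZon_add` (the classes are additive in
the constant — needed because the zeroth-order coefficient operator of hypothesis (L), field `zAm₀` of
`…B9SectCDiffEstimate.EstHyp`, is COMPOSITE: by Balaban 1985b (3.88) p. 409 and (3.103)–(3.104) p. 414 the
operator `K(h)` *"is a sum of a first order differential operator and the last two terms on the right-hand
side of (3.103)"* — a local `(Δh)`-stencil part (§3 `opZon_of_local`) plus the cut block-range term `𝔇(A′)` (§2
`opZon_of_cut` on `T = A′`; in the tree `…B9SectCDiffExpansion.TwoSeq.ddA'_eq : ddA' = dDtD + dΛ' + dA'`));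
`opDec_of_rowsum` / `opDec_of_rowsum_local` / `opZon_of_rowsum` (a blockwise ROW-SUM bound of the printed shape IS
an `OpDec` / `OpZon` — the level-uniform datum for the MULTILEVEL averaging operators `Q(𝔅(□)), Q′` with coarse
rows, p. 408, whose block row sums are `≤ O(1)` at every level while a global locality count is not level-uniform;
`opDec_of_local` of §3 remains the tool for the fine-row `Q*, Q′*` and for the six coefficient operators). -/

section Closure

variable {S : Type*} {F : Frame S}
variable {u v U V : Type*} [Fintype v] [DecidableEq V] {bu : u → U} {bv : v → V} {pU : U → S} {pV : V → S}

/-- `WDec` is additive in the constant (same weight, same rate) [folklore]. -/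
theorem wdec_add {l m : Type*} {ρ : S → S → ℝ} {pl : l → S} {pm : m → S} {ω : S → ℝ} {c c' δ : ℝ}
    {A B : Matrix l m ℝ} (hA : WDec ρ pl pm ω c δ A) (hB : WDec ρ pl pm ω c' δ B) :
    WDec ρ pl pm ω (c + c') δ (A + B) := by
  intro i j
  rw [Matrix.add_apply]
  calc |A i j + B i j| ≤ |A i j| + |B i j| := abs_add_le _ _
    _ ≤ c * ω (pl i) * Real.exp (-(δ * ρ (pl i) (pm j)))
        + c' * ω (pl i) * Real.exp (-(δ * ρ (pl i) (pm j))) := add_le_add (hA i j) (hB i j)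
    _ = (c + c') * ω (pl i) * Real.exp (-(δ * ρ (pl i) (pm j))) := by ring

/-- `𝒟ₙ(k, c₁) + 𝒟ₙ(k, c₂) ⊆ 𝒟ₙ(k, c₁ + c₂)` [folklore]. -/
theorem opDec_add {n : ℕ} {k : ℤ} {c₁ c₂ : ℝ} {T₁ T₂ : Matrix u v ℝ} (h₁ : OpDec F bu bv pU pV n k c₁ T₁)
    (h₂ : OpDec F bu bv pU pV n k c₂ T₂) : OpDec F bu bv pU pV n k (c₁ + c₂) (T₁ + T₂) := by
  obtain ⟨K₁, hB₁, hW₁⟩ := h₁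
  obtain ⟨K₂, hB₂, hW₂⟩ := h₂
  exact ⟨K₁ + K₂, hB₁.add hB₂, wdec_add hW₁ hW₂⟩

/-- `𝒵(k, θ₁) + 𝒵(k, θ₂) ⊆ 𝒵(k, θ₁ + θ₂)`: the zone condition survives because the majorants are termwise and a
nonzero entry of `K₁ + K₂` has a nonzero summand [folklore] (XREAD C-pv07-37 R5-1). -/
theorem opZon_add {k : ℤ} {θ₁ θ₂ : ℝ} {Z₁ Z₂ : Matrix u v ℝ} (h₁ : OpZon F bu bv pU pV k θ₁ Z₁)
    (h₂ : OpZon F bu bv pU pV k θ₂ Z₂) : OpZon F bu bv pU pV k (θ₁ + θ₂) (Z₁ + Z₂) := by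
  obtain ⟨K₁, hB₁, hW₁, hR₁⟩ := h₁
  obtain ⟨K₂, hB₂, hW₂, hR₂⟩ := h₂
  refine ⟨K₁ + K₂, hB₁.add hB₂, wdec_add hW₁ hW₂, fun i j hne => ?_⟩
  by_cases hz : K₁ i j = 0
  · have hz₂ : K₂ i j ≠ 0 := by
      intro hz₂; apply hne; rw [Matrix.add_apply, hz, hz₂, add_zero]
    exact hR₂ i j hz₂
  · exact hR₁ i j hz

/-- ROW-SUM constructor: a blockwise row-sum bound of the printed shape IS an `OpDec` (no locality count;
level-uniform for multilevel averaging operators, whose block row sums are `≤ O(1)` at every level, Balaban 1985b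
p. 408) [folklore] (XREAD C-pv07-37 R5-2). -/
theorem opDec_of_rowsum (hF : F.Valid) {n : ℕ} {k : ℤ} {θ₁ : ℝ} {T : Matrix u v ℝ} (hθ : 0 ≤ θ₁)
    (hrow : ∀ x J, ∑ x' ∈ univ.filter (fun x' => bv x' = J), |T x x'|
      ≤ θ₁ * F.sc (pU (bu x)) ^ k * Real.exp (-(F.rate n * F.ρ (pU (bu x)) (pV J)))) :
    OpDec F bu bv pU pV n k θ₁ T := by
  have h0 : ∀ I J, 0 ≤ θ₁ * F.sc (pU I) ^ k * Real.exp (-(F.rate n * F.ρ (pU I) (pV J))) := fun I J =>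
    mul_nonneg (mul_nonneg hθ (hF.sc_zpow_nonneg k _)) (Real.exp_nonneg _)
  refine OpDec.of_parts (K := fun I J => θ₁ * F.sc (pU I) ^ k * Real.exp (-(F.rate n * F.ρ (pU I) (pV J))))
    ⟨h0, fun x J => hrow x J⟩ fun I J => ?_
  exact (abs_of_nonneg (h0 I J)).le

/-- ROW-SUM constructor, localised form: blockwise row sums `≤ θ₁·sc(row block)ᵏ` plus block range `≤ r`
⇒ `𝒟ₙ(k, θ₁·e^{rateₙ·r})` [folklore] (XREAD C-pv07-37 R5-2′). -/
theorem opDec_of_rowsum_local (hF : F.Valid) {n : ℕ} {k : ℤ} {θ₁ r : ℝ} {T : Matrix u v ℝ} (hθ : 0 ≤ θ₁)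
    (hrow : ∀ x J, ∑ x' ∈ univ.filter (fun x' => bv x' = J), |T x x'| ≤ θ₁ * F.sc (pU (bu x)) ^ k)
    (hloc : ∀ x x', T x x' ≠ 0 → F.ρ (pU (bu x)) (pV (bv x')) ≤ r) (hrate : 0 ≤ F.rate n) :
    OpDec F bu bv pU pV n k (θ₁ * Real.exp (F.rate n * r)) T := by
  classical
  refine opDec_of_rowsum hF (mul_nonneg hθ (Real.exp_nonneg _)) fun x J => ?_
  by_cases hJ : ∃ x', bv x' = J ∧ T x x' ≠ 0
  · obtain ⟨x₀, hx₀J, hx₀⟩ := hJ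
    have hρ : F.ρ (pU (bu x)) (pV J) ≤ r := hx₀J ▸ hloc x x₀ hx₀
    have hexp : 1 ≤ Real.exp (F.rate n * r) * Real.exp (-(F.rate n * F.ρ (pU (bu x)) (pV J))) := by
      rw [← Real.exp_add]
      exact Real.one_le_exp (by nlinarith [mul_le_mul_of_nonneg_left hρ hrate])
    calc ∑ x' ∈ univ.filter (fun x' => bv x' = J), |T x x'| ≤ θ₁ * F.sc (pU (bu x)) ^ k := hrow x J
      _ ≤ θ₁ * F.sc (pU (bu x)) ^ k *
            (Real.exp (F.rate n * r) * Real.exp (-(F.rate n * F.ρ (pU (bu x)) (pV J)))) :=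
          le_mul_of_one_le_right (mul_nonneg hθ (hF.sc_zpow_nonneg k _)) hexp
      _ = θ₁ * Real.exp (F.rate n * r) * F.sc (pU (bu x)) ^ k *
            Real.exp (-(F.rate n * F.ρ (pU (bu x)) (pV J))) := by ring
  · have hJ' : ∀ x', bv x' = J → T x x' = 0 := fun x' hx' => by
      by_contra hT; exact hJ ⟨x', hx', hT⟩
    have : ∑ x' ∈ univ.filter (fun x' => bv x' = J), |T x x'| = 0 :=
      sum_eq_zero fun x' hx' => by rw [hJ' x' (mem_filter.1 hx').2, abs_zero]
    rw [this]
    exact mul_nonneg (mul_nonneg (mul_nonneg hθ (Real.exp_nonneg _)) (hF.sc_zpow_nonneg k _))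
      (Real.exp_nonneg _)

/-- ROW-SUM constructor for the zone class: blockwise row sums of the printed shape at rate `δ₀` plus the zone
condition on the rows carrying a nonzero entry ⇒ `𝒵(k, θ₁)` [folklore]. -/
theorem opZon_of_rowsum (hF : F.Valid) {k : ℤ} {θ₁ : ℝ} {T : Matrix u v ℝ} (hθ : 0 ≤ θ₁)
    (hrow : ∀ x J, ∑ x' ∈ univ.filter (fun x' => bv x' = J), |T x x'|
      ≤ θ₁ * F.sc (pU (bu x)) ^ k * Real.exp (-(F.δ₀ * F.ρ (pU (bu x)) (pV J))))
    (hz : ∀ x x', T x x' ≠ 0 → F.β (pU (bu x)) = 0) : OpZon F bu bv pU pV k θ₁ T := by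
  classical
  -- the majorant: the printed row-sum bound on the row blocks that carry a nonzero entry, zero elsewhere
  let K : Matrix U V ℝ := fun I J =>
    if ∃ x x', bu x = I ∧ bv x' = J ∧ T x x' ≠ 0 then
      θ₁ * F.sc (pU I) ^ k * Real.exp (-(F.δ₀ * F.ρ (pU I) (pV J))) else 0
  have hK : ∀ I J, K I J = if ∃ x x', bu x = I ∧ bv x' = J ∧ T x x' ≠ 0 then
      θ₁ * F.sc (pU I) ^ k * Real.exp (-(F.δ₀ * F.ρ (pU I) (pV J))) else 0 := fun I J => rfl
  have h0 : ∀ I J, 0 ≤ θ₁ * F.sc (pU I) ^ k * Real.exp (-(F.δ₀ * F.ρ (pU I) (pV J))) := fun I J =>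
    mul_nonneg (mul_nonneg hθ (hF.sc_zpow_nonneg k _)) (Real.exp_nonneg _)
  have hK0 : ∀ I J, 0 ≤ K I J := fun I J => by
    rw [hK]; split_ifs
    · exact h0 I J
    · exact le_rfl
  have hKle : ∀ I J, K I J ≤ θ₁ * F.sc (pU I) ^ k * Real.exp (-(F.δ₀ * F.ρ (pU I) (pV J))) := fun I J => by
    rw [hK]; split_ifs
    · exact le_rfl
    · exact h0 I J
  refine OpZon.of_parts (K := K) ⟨hK0, fun x J => ?_⟩ (fun I J => ?_) (fun I J hne => ?_)
  · -- block row sums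
    by_cases hJ : ∃ x', bv x' = J ∧ T x x' ≠ 0
    · obtain ⟨x₀, hx₀J, hx₀⟩ := hJ
      have hKIJ : K (bu x) J = θ₁ * F.sc (pU (bu x)) ^ k * Real.exp (-(F.δ₀ * F.ρ (pU (bu x)) (pV J))) := by
        rw [hK, if_pos ⟨x, x₀, rfl, hx₀J, hx₀⟩]
      rw [hKIJ]; exact hrow x J
    · have hJ' : ∀ x', bv x' = J → T x x' = 0 := fun x' hx' => by
        by_contra hT; exact hJ ⟨x', hx', hT⟩
      have : ∑ x' ∈ univ.filter (fun x' => bv x' = J), |T x x'| = 0 :=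
        sum_eq_zero fun x' hx' => by rw [hJ' x' (mem_filter.1 hx').2, abs_zero]
      rw [this]; exact hK0 _ _
  · -- weighted decay at rate δ₀ = rate 0
    rw [F.rate_zero, abs_of_nonneg (hK0 I J)]; exact hKle I J
  · -- zone condition
    have hex : ∃ x x', bu x = I ∧ bv x' = J ∧ T x x' ≠ 0 := by
      by_contra h; apply hne; rw [hK, if_neg h]
    obtain ⟨x, x', hxI, -, hT⟩ := hex
    rw [← hxI]; exact hz x x' hT

end Closure

end Literature.MathematicalPhysics.QuantumFieldTheory.Balaban1983to89.B9SectCDiffDict
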